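import Literature.MathematicalPhysics.QuantumFieldTheory.Balaban1983to89.B6KLevelFamilyWitnessV1
import Literature.MathematicalPhysics.QuantumFieldTheory.Balaban1983to89.B6KLevelCensusIndexV1
import HarnessLib

/-!
# `Balaban1983to89.B6KLevelFamilyWitnessOddLV1` — T. Bałaban, *Propagators and renormalization transformations for lattice gauge theories. II*,
Comm. Math. Phys. **96** (1984) 223–250 [Balaban1984PropagatorsII], (2.1)–(2.4) p. 224 and (2.16) p. 225: **NON-VACUITY OF THE FULL BINDER LIST OF THE
k-LEVEL THEOREMS OF ROUTES V/W ON THE V1 TORUS AT EVERY ODD `L ≥ 5`** — the odd-`L` twin of r03's `B6KLevelFamilyWitnessV1.kLevelFamily_nonvacuous_L5`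
(there: `L = 5` only, because the canonical index-`2` chart places TOP cubes only for `L ≤ 5`, `B6CubeWindowV1.placed_top`), and the RE-INDEXING lemmas
that say what the witness certifies.

HONEST FRAMING (programme rule): statement-level skeleton of published theorems with citation tags; proofs where landed; nothing here
is a claim about the Yang–Mills mass gap.

WHAT IS PRINTED (p. 224): (2.1) «a sequence of domains Ω_j ⊂ T_η, j = 1, …, k … Ω_j ⊃ Ω_{j+1}», «We admit the case when some domains Ω_j are equal
to T_η»; (2.2) «M is a size of big blocks … which will be fixed later»; (2.16) the weight band.  The tree's k-level binder list (the fields of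
`B6KLevelCensusIndexV1.KIdx`: V1 parameters `(m, K)`, a nested torus family `D : TDomains d ℓ M_h k P′ R` with `M_h = Lᵃ ≥ 8`, `R ≥ 2L²`, `P′ ≥ 5`, `4 ≤ ℓ`,
`k ≥ 2`, EVERY cube `Placed`, `c_f ≠ 0`, weights in the band) does NOT require the nominal top level `k` to be inhabited (`TDomains.lev_le : lev ≤ k` only).

## WHAT THIS FILE CERTIFIES (kernel-checked, sorry-free, standard axioms; THEOREMS ONLY)

* §1 **RE-INDEXING** (`N0_succ_eq`, `exists_reindexUp`, `exists_reindexDown`, `cubes_eq_of_lev_eq`, `placed_of_lev_le`): on the torus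
  `N₀ = L^{j+1}·L·M_h·P′ = L^j·L·M_h·(L·P′)` a nominal-`(j+1)` family whose top level is EMPTY (`lev ≤ j`) and a `j`-level family with `P′ ↦ L·P′` are
  THE SAME DATA (same level function, same big blocks `B^i` of side `M_h·L^{i+1}`, same (2.1), same torus (2.2)); the cubes of the cover agree, and every
  cube of a top-empty family is `Placed` at ANY `L` (`B6CubeWindowV1.placed_of_lt`: the index-`2` obstruction bites only at the nominal top level).
* §2 **THE TOP-EMPTY TWO-LEVEL MEMBER** (`exists_twoTopBelow_TDomains`): for `k ≥ 3` a nested family on every torus with `Ω₁ = … = Ω_{k−2} = T_η`,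
  `Ω_{k−1}` = one big `(k−1)`-block, `Ω_k = ∅` (p21's `topLev ℓ (k−1) M_h` read at nominal index `k`); for `k = 2` the one-level member `lev ≡ 1`
  (`exists_const_TDomains`).
* §3 **`kLevelFamily_nonvacuous_oddL`**: for EVERY even `ℓ ≥ 4` (odd `L = ℓ + 1 ≥ 5`), every `d`, `k ≥ 2`, `M₂`, `N₁`, `0 < b₀ ≤ b₁` there are
  `m, K, M_h = Lᵃ ≥ 8, R = 2L², P′ ≡ 2L²`, `hN`, a nested torus family `D`, `k ≤ m + K` and weights `w` meeting EVERY binder of the k-level theorems,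
  with `lev ≤ k − 1` everywhere, sites at level `k − 1`, and at level `k − 2` when `k ≥ 3`.
* §4 **`kIdx_nonvacuous_oddL`**: the index `B6KLevelCensusIndexV1.KIdx d ℓ hd hL b₀ b₁` of the genuine k-level family is INHABITED at every even `ℓ ≥ 4`,
  every `k ≥ 2` and EVERY fine-lattice factor `c_f ≠ 0` (print's units `c_f = Lᵏ` included), beyond both census thresholds (`M₁ ≤ M = L·M_h`,
  `N₁ + 1 ≤ R·L·M_h`), by the top-empty member of §3 (weights rescaled by `c_f²`) — the odd-`L` twin of r03's
  `B6Prop26Census2136KLevelV1.kLevelG_meets_hypotheses` (`L = 5`).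

## HONEST SCOPE

(1) What the witness is: a genuine `(k−1)`-level family of (2.1)–(2.4) (two inhabited levels for `k ≥ 3`, (2.2) void for it exactly as for r03's / p21's /
p22's witnesses) READ ONE NOMINAL LEVEL UP, in the units `η = L^{−k}` of the nominal index; by §1 every genuine multi-level V1 torus family with any number
`j` of levels is such a member at nominal index `j + 1` (with `P′/L`, which the V1 side `2L^{m+K}` always affords).  So at odd `L ≥ 7` the census / tower
theorems of record indexed by `KIdx` / `Node00.KRIdx` quantify NON-VACUOUSLY, and over (re-indexed copies of) all genuine families; what is NOT in the tree
at odd `L ≥ 7` is only a member whose NOMINAL top level `k` is inhabited (that needs the deeper chart `B6Partition118KLevelTorusCentralAt.ccAt` carried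
through a twin of `B6CubeWindowV1` — not done here).  (2) No inequality of print is claimed; no operator-level identification of the re-indexed
member's `G, Q, H` with the `j`-level ones is proved here (the level data agree by §1; the operator dictionaries are index-free by inspection of
`B6GlobalChartV1.domT`, not by a theorem of this file).  THEOREMS ONLY; no definition, no `def … : Prop`.  NOT summit progress.
Unit `pub-ymgap-dag-p1` (g4), 2026-08-26 — N03 [B6] row, located caveat (c7) of the chair's count line R443.
-/

namespace Literature.MathematicalPhysics.QuantumFieldTheory.Balaban1983to89.B6KLevelFamilyWitnessOddLV1

open B4Reflection242 (boxDom mem_boxDom blk)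
open B4TorusKernel.MultiPeriod (torusSupNorm)
open B6MultiLevelBoxOperator (Domains N0 bigSide one_le_bigSide)
open B6MultiLevelTorusOperator (TDomains N0_eq_bigSide_mul)
open B6GlobalChartV1 (PV domT)
open B6SectAOperatorsV1 (BondIdx)
open B6CubeWindowV1 (Placed GlobalBand placed_of_lt)
open B6Cover236MultiLevelBlocks (cubes)
open B6Prop22KLevelTorusCensus (KTIdx)
open B6V1TorusWitness (topLev_zero topLev_corner corner_mem_boxDom exists_twoTop_TDomains)
open B6KLevelFamilyWitnessV1 (N0_V1_pow globalBand_witness exists_exponent)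
open B6KLevelCensusIndexV1 (KIdx kGeoG)

variable {d : ℕ}

/-! ## §1 Re-indexing: a top-empty nominal-`(j+1)` family IS a `j`-level family with `P′ ↦ L·P′` -/

/-- **THE TORUS SIDE IS INDEX-FREE**: `N₀(ℓ, M_h, j+1, P′) = N₀(ℓ, M_h, j, L·P′)` (`= L^{j+1}·L·M_h·P′`). [cite: Balaban1984PropagatorsII, (2.1) p.224, bookkeeping] -/
theorem N0_succ_eq (ℓ Mh j : ℕ) (P : Fin (d + 1) → ℕ) : N0 ℓ Mh (j + 1) P = N0 ℓ Mh j (fun μ => (ℓ + 1) * P μ) := by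
  funext μ
  show (ℓ + 1) ^ (j + 1) * ((ℓ + 1) * (Mh * P μ)) = (ℓ + 1) ^ j * ((ℓ + 1) * (Mh * ((ℓ + 1) * P μ)))
  ring

/-- **RE-INDEXING UP**: a `j`-level family of (2.1)–(2.4) on the torus of side `N₀(ℓ, M_h, j, L·P′)` is a nominal-`(j+1)` family on the SAME torus
`N₀(ℓ, M_h, j+1, P′)` with the SAME level function (hence the same domains `Ω_i`, big blocks, (2.1) and torus (2.2)), whose top level `j + 1` is empty.
[cite: Balaban1984PropagatorsII, (2.1)–(2.4) p.224 («We admit the case when some domains Ω_j are equal to T_η»; here Ω_{j+1} = ∅ is the degenerate top)] -/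
theorem exists_reindexUp {ℓ Mh j R : ℕ} {P : Fin (d + 1) → ℕ} (D : TDomains d ℓ Mh j (fun μ => (ℓ + 1) * P μ) R) :
    ∃ D' : TDomains d ℓ Mh (j + 1) P R, D'.lev = D.lev := by
  have hN := N0_succ_eq (d := d) ℓ Mh j P
  exact ⟨{ lev := D.lev
           one_le_lev := D.one_le_lev
           lev_le := fun x => (D.lev_le x).trans (Nat.le_succ j)
           bigBlocks := fun i hi x hx x' hx' hb => D.bigBlocks i hi x (hN ▸ hx) x' (hN ▸ hx') hb
           sepT := fun i x hx x' hx' h1 h2 => by rw [hN]; exact D.sepT i x (hN ▸ hx) x' (hN ▸ hx') h1 h2 }, rfl⟩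

/-- **RE-INDEXING DOWN**: a nominal-`(j+1)` family whose top level is empty (`lev ≤ j`) is a `j`-level family of (2.1)–(2.4) on the same torus with
`P′ ↦ L·P′`, same level function. [cite: Balaban1984PropagatorsII, (2.1)–(2.4) p.224] -/
theorem exists_reindexDown {ℓ Mh j R : ℕ} {P : Fin (d + 1) → ℕ} (D : TDomains d ℓ Mh (j + 1) P R) (htop : ∀ x, D.lev x ≤ j) :
    ∃ D' : TDomains d ℓ Mh j (fun μ => (ℓ + 1) * P μ) R, D'.lev = D.lev := by
  have hN := N0_succ_eq (d := d) ℓ Mh j P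
  exact ⟨{ lev := D.lev
           one_le_lev := D.one_le_lev
           lev_le := htop
           bigBlocks := fun i hi x hx x' hx' hb => D.bigBlocks i hi x (hN ▸ hx) x' (hN ▸ hx') hb
           sepT := fun i x hx x' hx' h1 h2 => by rw [← hN]; exact D.sepT i x (hN ▸ hx) x' (hN ▸ hx') h1 h2 }, rfl⟩

/-- **THE COVER IS INDEX-FREE**: two families on the same fundamental box with the same level function have the same cubes `(j(y), β(y))`
(p. 229 «cubes □ … with a center y ∈ Λ_j»). [cite: Balaban1984PropagatorsII, p.229 before (2.36), bookkeeping] -/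
theorem cubes_eq_of_lev_eq {ℓ Mh k k' R R' : ℕ} {P P' : Fin (d + 1) → ℕ} (D : Domains d ℓ Mh k P R) (D' : Domains d ℓ Mh k' P' R')
    (hN : N0 ℓ Mh k P = N0 ℓ Mh k' P') (hlev : D'.lev = D.lev) : cubes D' = cubes D := by
  unfold cubes; rw [hN, hlev]

/-- **EVERY CUBE OF A TOP-EMPTY FAMILY IS PLACED, AT ANY `L`** (`P′ ≥ 5`): its level is `< k`, so the canonical index-`2` chart places it
(`B6CubeWindowV1.placed_of_lt`); the obstruction `placed_top ⇔ L ≤ 5` concerns cubes of the NOMINAL top level only.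
[cite: Balaban1984PropagatorsII, p.229 («cubes □ of the size 2ML^jη»), dictionary (charts)] -/
theorem placed_of_lev_le {ℓ Mh k R : ℕ} {P : Fin (d + 1) → ℕ} (D : Domains d ℓ Mh k P R) (hP5 : ∀ μ, 5 ≤ P μ) {j : ℕ} (hjk : j < k)
    (htop : ∀ x, D.lev x ≤ j) : ∀ c : ↥(cubes D), Placed ℓ k P c.1 := by
  intro c
  obtain ⟨x, _, hx⟩ := Finset.mem_image.1 c.2
  refine placed_of_lt hP5 c.1 ?_
  have h1 : c.1.1 = D.lev x := (congrArg Prod.fst hx).symm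
  rw [h1]; exact lt_of_le_of_lt (htop x) hjk

/-! ## §2 The top-empty members on every torus -/

/-- **THE ONE-LEVEL MEMBER AT ANY NOMINAL INDEX**: `lev ≡ j` (`1 ≤ j ≤ k`): (2.1) trivially, (2.2) void.
[cite: Balaban1984PropagatorsII, (2.1) p.224 («We admit the case when some domains Ω_j are equal to T_η»)] -/
theorem exists_const_TDomains (d ℓ Mh k : ℕ) (P : Fin (d + 1) → ℕ) (R : ℕ) {j : ℕ} (h1 : 1 ≤ j) (hj : j ≤ k) :
    ∃ D : TDomains d ℓ Mh k P R, ∀ x, D.lev x = j :=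
  ⟨{ lev := fun _ => j
     one_le_lev := fun _ => h1
     lev_le := fun _ => hj
     bigBlocks := fun _ _ _ _ _ _ _ => Iff.rfl
     sepT := fun i x _ x' _ (h₁ : j < i) (h₂ : i + 1 ≤ j) => by exfalso; omega }, fun _ => rfl⟩

/-- **THE TOP-EMPTY TWO-LEVEL MEMBER ON EVERY TORUS** (`k ≥ 3`): `Ω₁ = … = Ω_{k−2} = T_η`, `Ω_{k−1}` = the big `(k−1)`-block at the origin, `Ω_k = ∅` —
p22's `exists_twoTop_TDomains` at index `k − 1` with `P′ ↦ L·P′`, re-indexed up (§1). [cite: Balaban1984PropagatorsII, (2.1)–(2.2) p.224] -/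
theorem exists_twoTopBelow_TDomains (d ℓ Mh k : ℕ) (P : Fin (d + 1) → ℕ) (R : ℕ) (hk : 3 ≤ k) :
    ∃ D : TDomains d ℓ Mh k P R, D.lev = KTIdx.topLev ℓ (k - 1) Mh := by
  obtain ⟨k', rfl⟩ : ∃ k', k = k' + 1 := ⟨k - 1, by omega⟩
  obtain ⟨D₀, hD₀⟩ := exists_twoTop_TDomains d ℓ Mh k' (fun μ => (ℓ + 1) * P μ) R (by omega)
  obtain ⟨D, hD⟩ := exists_reindexUp D₀
  exact ⟨D, by rw [hD, hD₀, Nat.add_sub_cancel]⟩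

/-! ## §3 The witness at every odd `L ≥ 5` -/

/-- **NON-VACUITY OF THE FULL k-LEVEL BINDER LIST AT EVERY ODD `L ≥ 5`**: for every even `ℓ ≥ 4` (`L = ℓ + 1`), every `d`, `k ≥ 2`, thresholds `M₂`, `N₁`
and band constants `0 < b₀ ≤ b₁` there are V1 parameters `m, K`, `M_h = Lᵃ ≥ 8`, `R = 2L²`, `P′_μ = 2L²`, the identification `hN` of the torus with the V1
torus, a nested torus family `D` whose nominal top level is EMPTY (`lev ≤ k − 1`), with sites at level `k − 1` and — when `k ≥ 3` — at level `k − 2`,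
`k ≤ m + K`, EVERY cube `Placed` (by `placed_of_lt`), `M₂ ≤ L·M_h`, `N₁ + 1 ≤ R·L·M_h`, and weights `w > 0` with `GlobalBand b₀ b₁ 1 w`: the binder list of
`B6KLevelCensusIndexV1.KIdx` (hence of `prop26_2136_kLevel_unconditional`, `prop27_kLevel_unconditional`, `cor28_kLevel_H(_DH)`, whose `4 ≤ ℓ` is `hℓ`) is
jointly satisfiable at every odd `L ≥ 5`. [cite: Balaban1984PropagatorsII, (2.1)–(2.4) p.224 («We admit the case when some domains Ω_j are equal to T_η»),
(2.2) p.224 («M is a size of big blocks and R is a big positive integer which will be fixed later»), Prop. 2.2 p.234 («M is sufficiently large»), (2.16) p.225] -/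
theorem kLevelFamily_nonvacuous_oddL (d ℓ k : ℕ) (hd : 1 ≤ d + 1) (hL : Odd (ℓ + 1) ∧ 1 < ℓ + 1) (hℓ : 4 ≤ ℓ) (hk : 2 ≤ k) (M₂ : ℝ) (N₁ : ℕ)
    {b₀ b₁ : ℝ} (hb₀ : 0 < b₀) (hb₁ : b₀ ≤ b₁) :
    ∃ (m K Mh R a : ℕ) (P' : Fin (d + 1) → ℕ) (hN : ∀ μ, N0 ℓ Mh k P' μ = (PV d ℓ m K hd hL).sitesPerDir 0)
      (D : TDomains d ℓ Mh k P' R) (hk' : k ≤ m + K) (w : BondIdx (domT hN D hk') → ℝ),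
      Mh = (ℓ + 1) ^ a ∧ 8 ≤ Mh ∧ 2 * (ℓ + 1) ^ 2 ≤ R ∧ (∀ μ, 5 ≤ P' μ) ∧
      (∀ c : ↥(cubes D.toDomains), Placed ℓ k P' c.1) ∧
      M₂ ≤ ((ℓ : ℝ) + 1) * Mh ∧ N₁ + 1 ≤ R * ((ℓ + 1) * Mh) ∧
      (∀ i, 0 < w i) ∧ GlobalBand b₀ b₁ 1 w ∧
      (∀ x, D.lev x ≤ k - 1) ∧ (∃ x ∈ boxDom (N0 ℓ Mh k P'), D.lev x = k - 1) ∧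
      (3 ≤ k → ∃ x ∈ boxDom (N0 ℓ Mh k P'), D.lev x = k - 2) := by
  obtain ⟨a, h8, hM₂, hN₁⟩ := exists_exponent ℓ (by omega) M₂ N₁ (2 * (ℓ + 1) ^ 2) (by nlinarith)
  have hMh : 1 ≤ (ℓ + 1) ^ a := Nat.one_le_pow _ _ (Nat.succ_pos ℓ)
  set P' : Fin (d + 1) → ℕ := fun _ => 2 * (ℓ + 1) ^ 2 with hP'
  have hP5 : ∀ μ : Fin (d + 1), 5 ≤ P' μ := fun μ => by simp only [hP']; nlinarith
  have hP1 : ∀ μ : Fin (d + 1), 1 ≤ P' μ := fun μ => le_trans (by norm_num) (hP5 μ)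
  have hN : ∀ μ, N0 ℓ ((ℓ + 1) ^ a) k P' μ = (PV d ℓ (k + a + 3) 0 hd hL).sitesPerDir 0 :=
    fun μ => N0_V1_pow ℓ k a 2 (k + a + 3) 0 hd hL (by ring) μ
  have hk' : k ≤ k + a + 3 + 0 := by omega
  have h0mem : (0 : Fin (d + 1) → ℤ) ∈ boxDom (N0 ℓ ((ℓ + 1) ^ a) k P') := by
    rw [mem_boxDom]; intro μ
    have := B6MultiLevelTorusOperator.one_le_N0 (ℓ := ℓ) (k := k) hMh hP1 μ
    simp only [Pi.zero_apply]; exact ⟨le_rfl, by exact_mod_cast this⟩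
  -- the member: two inhabited levels `k − 1`, `k − 2` when `k ≥ 3`, the one-level member `lev ≡ 1` when `k = 2`
  have hD : ∃ D : TDomains d ℓ ((ℓ + 1) ^ a) k P' (2 * (ℓ + 1) ^ 2),
      (∀ x, D.lev x ≤ k - 1) ∧ (∃ x ∈ boxDom (N0 ℓ ((ℓ + 1) ^ a) k P'), D.lev x = k - 1) ∧
      (3 ≤ k → ∃ x ∈ boxDom (N0 ℓ ((ℓ + 1) ^ a) k P'), D.lev x = k - 2) := by
    rcases Nat.lt_or_ge k 3 with h2 | h3
    · have hk2 : k = 2 := by omega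
      obtain ⟨D, hD⟩ := exists_const_TDomains d ℓ ((ℓ + 1) ^ a) k P' (2 * (ℓ + 1) ^ 2) (j := 1) le_rfl (by omega)
      exact ⟨D, fun x => by rw [hD x]; omega, ⟨0, h0mem, by rw [hD 0]; omega⟩, fun h => by exfalso; omega⟩
    · obtain ⟨D, hD⟩ := exists_twoTopBelow_TDomains d ℓ ((ℓ + 1) ^ a) k P' (2 * (ℓ + 1) ^ 2) h3
      refine ⟨D, fun x => ?_, ⟨0, h0mem, by rw [hD]; exact topLev_zero ℓ (k - 1) _⟩, fun _ => ?_⟩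
      · rw [hD]; rcases KTIdx.topLev_eq_or (d := d) ℓ (k - 1) ((ℓ + 1) ^ a) x with h | h <;> omega
      · refine ⟨_, ?_, by rw [hD, topLev_corner ℓ (k - 1) _ hMh]; omega⟩
        have hmem := corner_mem_boxDom (d := d) ℓ (k - 1) ((ℓ + 1) ^ a) (fun μ => (ℓ + 1) * P' μ) hMh
          (fun μ => le_trans (by norm_num : 2 ≤ 5) ((hP5 μ).trans (Nat.le_mul_of_pos_left _ (Nat.succ_pos ℓ))))
        have hNk : N0 ℓ ((ℓ + 1) ^ a) k P' = N0 ℓ ((ℓ + 1) ^ a) (k - 1) (fun μ => (ℓ + 1) * P' μ) := by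
          obtain ⟨k', rfl⟩ : ∃ k', k = k' + 1 := ⟨k - 1, by omega⟩
          rw [Nat.add_sub_cancel]; exact N0_succ_eq ℓ _ k' P'
        rwa [hNk]
  obtain ⟨D, htop, hx1, hx2⟩ := hD
  obtain ⟨w, hw, hwb⟩ := globalBand_witness (domT hN D hk') hb₀ hb₁
  refine ⟨k + a + 3, 0, (ℓ + 1) ^ a, 2 * (ℓ + 1) ^ 2, a, P', hN, D, hk', w, rfl, h8, le_rfl, hP5,
    placed_of_lev_le D.toDomains hP5 (j := k - 1) (by omega) htop, ?_, hN₁, hw, hwb, htop, hx1, hx2⟩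
  simpa using hM₂

/-! ## §4 The index `KIdx` of the genuine k-level family is inhabited at every odd `L ≥ 5`, in any units `c_f` -/

/-- **THE INDEX OF THE GENUINE k-LEVEL FAMILY IS INHABITED AT EVERY ODD `L ≥ 5`, IN ANY UNITS**: for every even `ℓ ≥ 4`, every `k ≥ 2`, every `c_f ≠ 0`, every
census threshold `M₁` and natural `N₁`, and every band `0 < b₀ ≤ b₁`, a member `i : KIdx d ℓ hd hL b₀ b₁` with `i.k = k`, `i.cf = c_f`, `M₁ ≤ M = L·M_h`,
`N₁ + 1 ≤ R·L·M_h`, whose nominal top level is empty (`lev ≤ k − 1`; sites at level `k − 1`, and at `k − 2` when `k ≥ 3`) — the `∀ i, Hyp → M₁ ≤ M → …` of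
the k-level censuses (`B6.Prop26Printed (kGeoG) (kG)`, `B6.Prop27Printed`, `B6.Cor28Printed` readings) are NOT vacuous at any odd `L ≥ 5`; the weights are
§3's band-`(2.16)` weights at `c_f = 1` rescaled by `c_f²`. [cite: Balaban1984PropagatorsII, (2.1)–(2.4) p.224, (2.16) p.225, Prop. 2.2 p.234 («M is sufficiently large»), Prop. 2.6 p.247] -/
theorem kIdx_nonvacuous_oddL (d ℓ k : ℕ) (hd : 1 ≤ d + 1) (hL : Odd (ℓ + 1) ∧ 1 < ℓ + 1) (hℓ : 4 ≤ ℓ) (hk : 2 ≤ k) {cf : ℝ} (hcf : cf ≠ 0)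
    (M₁ : ℝ) (N₁ : ℕ) {b₀ b₁ : ℝ} (hb₀ : 0 < b₀) (hb₁ : b₀ ≤ b₁) :
    ∃ i : KIdx d ℓ hd hL b₀ b₁, i.k = k ∧ i.cf = cf ∧ (kGeoG i).Hyp21_22 ∧ M₁ ≤ (kGeoG i).M ∧ N₁ + 1 ≤ i.R * ((ℓ + 1) * i.Mh) ∧
      (∀ x, i.D.lev x ≤ k - 1) ∧ (∃ x ∈ boxDom (N0 ℓ i.Mh i.k i.P'), i.D.lev x = k - 1) ∧
      (3 ≤ k → ∃ x ∈ boxDom (N0 ℓ i.Mh i.k i.P'), i.D.lev x = k - 2) := by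
  obtain ⟨m, K, Mh, R, a, P', hN, D, hk', w, hMha, hM8, hR2, hP5, hpl, hM, hN₁, hw, hwb, htop, hx1, hx2⟩ :=
    kLevelFamily_nonvacuous_oddL d ℓ k hd hL hℓ hk M₁ N₁ hb₀ hb₁
  have hwb' : GlobalBand b₀ b₁ cf (fun i => cf ^ 2 * w i) := by
    intro i
    obtain ⟨h1, h2⟩ := hwb i
    have key : cf ^ 2 * w i / (cf / (((ℓ + 1 : ℕ) : ℝ)) ^ (i.1.1 : ℕ)) ^ 2 = w i / (1 / (((ℓ + 1 : ℕ) : ℝ)) ^ (i.1.1 : ℕ)) ^ 2 := by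
      field_simp
    rw [key]
    exact ⟨h1, h2⟩
  refine ⟨⟨m, K, Mh, k, R, a, P', hN, D, hk', hk, hMha, hM8, hR2, hP5, hℓ, hpl, cf, hcf, fun i => cf ^ 2 * w i,
    fun i => mul_pos (by positivity) (hw i), hwb'⟩, rfl, rfl, trivial, ?_, hN₁, htop, hx1, hx2⟩
  show M₁ ≤ (((ℓ + 1 : ℕ) : ℝ)) * (Mh : ℝ)
  have hcast : (((ℓ + 1 : ℕ) : ℝ)) = (ℓ : ℝ) + 1 := by push_cast; ring
  rw [hcast]; exact hM

end Literature.MathematicalPhysics.QuantumFieldTheory.Balaban1983to89.B6KLevelFamilyWitnessOddLV1
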